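import Summits.QuantumFields.YangMills.Theorems.IR.BlockedActivityWStrongCouplingMesh
import Summits.QuantumFields.YangMills.Theorems.IR.BlockedActivityWRatioClauseI
import HarnessLib

/-!
# Crux `IR` (stmt-QuantumFields-19354), lane B «strong coupling AFTER BLOCKING»: corollaries of the class-W-at-every-mesh theorem — RATIO clause (i)
# for every class, the COFINAL mixing meshes of the strong window, and the class at THE NUMBER `a⋆` at EVERY mesh `≥ 32`

Helper module for item `stmt-QuantumFields-19354` (`--supports`; it closes nothing), lane `ym-19354-onsetsc-p2` (g3).

WHAT IS HERE (all proved; `216·N·|β| ≤ 1`, every compact `G`, every lattice representation `r`).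
* `ratioClauseI_strongCoupling` — RATIO clause (i) holds on every mesh-`b` frame (`b, n ≥ 1`) for EVERY `Typ` with `A = 3072 b⁴ e^{24N|β|} 2^{−2nb}`.
* `univShellCond_strongCoupling_eventually` ∕ `typShellCondUKPc_strongCoupling_eventually` — SCALE AXIS, strong end with every mesh: for every
  admissible accuracy `0 < ε ≤ 1` and window `n ≥ 1` there is `b₀` with `UnivShellCond r.ρ β b n ε` and format Uc `TypShellCondUKPc r.ρ β b n ε δ`
  (every `δ`) for ALL `b ≥ b₀` and ALL `β` in the strong window: the set of Uc-mixing meshes is COFINAL there (the tree had the endpoint `b = 1`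
  only, `one_mem_fmtSetUc_of_smallBeta`, and the `b⁻⁴`-receding window of `univShellCond_of_smallBeta_mesh`).
* `blockedActivityClassW_radiusKP_of_ge_32` ∕ `univShellCond_of_ge_32` — the class at THE NUMBER `a⋆ = radiusKP (1∕3552)` at EVERY mesh `b ≥ 32`
  (window 1): the majorant `b⁴·4^{−b}` is non-increasing, so the certified digit `b_hand(a⋆) ≤ 32` is a threshold, not an instance.

HONEST FRAMING: a strong-coupling (high-temperature) calibration; nothing about weak coupling, a gap or Clay.  No `sorry`; axioms ⊆ {propext,
Classical.choice, Quot.sound}; no instances, no notation.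
-/

set_option autoImplicit false

noncomputable section

open MeasureTheory ProbabilityTheory
open Literature.MathematicalPhysics.QuantumLattice
open Literature.Probability.LatticeModels
open Summit.QuantumFields.YangMills.Cruxes.IR.Tempered (cellEdges windowCells regionEdges collarEdges)
open Summit.QuantumFields.YangMills.Cruxes.IR.CellTempered.Engine (shiftFrame shiftFrame_mesh)
open Summit.QuantumFields.YangMills.Cruxes.IR.OnsetFormats (UnivShellCond)
open Summit.QuantumFields.YangMills.Cruxes.IR.OnsetFormatsUc (TypShellCondUKPc typShellCondUKPc_of_univShellCond)

namespace Summit.QuantumFields.YangMills.Cruxes.IR.BlockedActivity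

/-! ## §1 Strong coupling: RATIO clause (i) for every class, and the cofinal mixing meshes of the strong window -/

section Strong

variable (G : Type) [Group G] [TopologicalSpace G] [IsTopologicalGroup G] [CompactSpace G] [MeasurableSpace G] [BorelSpace G]
  (r : Literature.MathematicalPhysics.QuantumFieldTheory.LatticeRep G)

/-- **RATIO clause (i) at strong coupling, every mesh, every class**: at `216·N·|β| ≤ 1`, on every mesh-`b` frame (`b ≥ 1`), window `n ≥ 1`,
`RatioClauseI r.ρ β w n (3072 b⁴ e^{24N|β|} 2^{−2nb}) Typ` for EVERY `Typ` (typicality is not used). -/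
theorem ratioClauseI_strongCoupling {β : ℝ} (hβ : 216 * (r.N : ℝ) * |β| ≤ 1) {w : Fin 4 → ℤ → ℤ} {b n : ℕ}
    (hw : AfPincerUc.IsFrame b w) (hb : 1 ≤ b) (hn : 1 ≤ n) (Typ : Cell → Set (LGConfig 4 G)) :
    RatioClauseI r.ρ β w n (3072 * (b : ℝ) ^ 4 * Real.exp (24 * r.N * |β|) * (1 / 2 : ℝ) ^ (2 * n * b)) Typ :=
  fun _ _ h0 _ _ _ _ hσ' U U' => centreRatio_le_exp_mul_strongCoupling G r hβ hw hb hn h0 hσ' U' U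

/-- **SCALE AXIS, strong end at every mesh: the universal shell condition at ALL large meshes, uniformly in the strong window.**  For every
admissible accuracy `0 < ε ≤ 1` and window `n ≥ 1` there is `b₀ ≥ 1` with `UnivShellCond r.ρ β b n ε` for all `b ≥ b₀` and all `216N|β| ≤ 1`
(class W at radius `radiusKP ε` by `blockedActivityClassW_strongCoupling_eventually`, then the tree's sharp reduction). -/
theorem univShellCond_strongCoupling_eventually {ε : ℝ} (hε : 0 < ε) (hε1 : ε ≤ 1) {n : ℕ} (hn : 1 ≤ n) :
    ∃ b₀ : ℕ, 1 ≤ b₀ ∧ ∀ b : ℕ, b₀ ≤ b → ∀ β : ℝ, 216 * (r.N : ℝ) * |β| ≤ 1 → UnivShellCond r.ρ β b n ε := by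
  obtain ⟨b₀, hb₀, h⟩ := blockedActivityClassW_strongCoupling_eventually G r (radiusKP_pos hε) hn
  exact ⟨b₀, hb₀, fun b hb β hβ => univShellCond_of_blockedActivityW_sharp (h b hb β hβ) hε1 le_rfl⟩

/-- **The Uc-mixing meshes are COFINAL in the strong window**: format Uc `TypShellCondUKPc r.ρ β b n ε δ` (every `δ`, class `Typ ≡ univ`) at all
large meshes — against the single certified endpoint `b = 1` (`one_mem_fmtSetUc_of_smallBeta`) and the `b⁻⁴`-receding window of
`univShellCond_of_smallBeta_mesh` the tree had so far. -/
theorem typShellCondUKPc_strongCoupling_eventually {ε : ℝ} (hε : 0 < ε) (hε1 : ε ≤ 1) {n : ℕ} (hn : 1 ≤ n) :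
    ∃ b₀ : ℕ, 1 ≤ b₀ ∧ ∀ b : ℕ, b₀ ≤ b → ∀ β : ℝ, 216 * (r.N : ℝ) * |β| ≤ 1 → ∀ δ : ℝ, TypShellCondUKPc r.ρ β b n ε δ := by
  obtain ⟨b₀, hb₀, h⟩ := univShellCond_strongCoupling_eventually G r hε hε1 hn
  exact ⟨b₀, hb₀, fun b hb β hβ δ => typShellCondUKPc_of_univShellCond (h b hb β hβ) δ⟩

/-! ## §2 Every mesh `≥ 32` at the KP hand-over radius (monotonicity of the majorant) -/

/-- `b⁴·4^{−b}` does not increase from `b = 3` on (`(b+1)⁴ ≤ (4b∕3)⁴ = (256∕81)·b⁴ ≤ 4·b⁴`). -/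
theorem quartic_geom_step {b : ℕ} (hb : 3 ≤ b) :
    (((b + 1 : ℕ) : ℝ)) ^ 4 * (1 / 4 : ℝ) ^ (b + 1) ≤ (b : ℝ) ^ 4 * (1 / 4 : ℝ) ^ b := by
  have hb' : (3 : ℝ) ≤ b := by exact_mod_cast hb
  have h1 : ((b + 1 : ℕ) : ℝ) ≤ 4 / 3 * b := by push_cast; linarith
  have h2 : ((b + 1 : ℕ) : ℝ) ^ 4 ≤ (4 / 3 * (b : ℝ)) ^ 4 := pow_le_pow_left₀ (by positivity) h1 4
  have hq : 0 ≤ (1 / 4 : ℝ) ^ b := by positivity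
  have h3 : ((b + 1 : ℕ) : ℝ) ^ 4 * (1 / 4 : ℝ) ^ b ≤ (4 / 3 * (b : ℝ)) ^ 4 * (1 / 4 : ℝ) ^ b := mul_le_mul_of_nonneg_right h2 hq
  have h4 : 0 ≤ (b : ℝ) ^ 4 * (1 / 4 : ℝ) ^ b := by positivity
  calc (((b + 1 : ℕ) : ℝ)) ^ 4 * (1 / 4 : ℝ) ^ (b + 1) = (((b + 1 : ℕ) : ℝ) ^ 4 * (1 / 4 : ℝ) ^ b) * (1 / 4) := by rw [pow_succ]; ring
    _ ≤ ((4 / 3 * (b : ℝ)) ^ 4 * (1 / 4 : ℝ) ^ b) * (1 / 4) := mul_le_mul_of_nonneg_right h3 (by norm_num)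
    _ = (64 / 81) * ((b : ℝ) ^ 4 * (1 / 4 : ℝ) ^ b) := by ring
    _ ≤ (b : ℝ) ^ 4 * (1 / 4 : ℝ) ^ b := by nlinarith

/-- Hence `b⁴·4^{−b} ≤ 32⁴·4^{−32}` for every `b ≥ 32`. -/
theorem quartic_geom_le_32 {b : ℕ} (hb : 32 ≤ b) : (b : ℝ) ^ 4 * (1 / 4 : ℝ) ^ b ≤ (32 : ℝ) ^ 4 * (1 / 4 : ℝ) ^ 32 := by
  induction b, hb using Nat.le_induction with
  | base => norm_num
  | succ b hb ih => exact (quartic_geom_step (by omega)).trans ih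

/-- **The radius stays below `10⁻⁹` at EVERY mesh `b ≥ 32`** (window `1`, whole strong window). -/
theorem meshRadiusSC_le_of_ge_32 {N : ℕ} {β : ℝ} (hβ : 216 * (N : ℝ) * |β| ≤ 1) {b : ℕ} (hb : 32 ≤ b) :
    meshRadiusSC N β b 1 ≤ (1 : ℝ) / 10 ^ 9 := by
  set t : ℝ := 3072 * (b : ℝ) ^ 4 * Real.exp (24 * N * |β|) * (1 / 2 : ℝ) ^ (2 * 1 * b) with ht
  have he : Real.exp (24 * N * |β|) ≤ Real.exp 1 := Real.exp_le_exp.2 (by nlinarith [abs_nonneg β, Nat.cast_nonneg (α := ℝ) N])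
  have he1 : Real.exp 1 ≤ 2.7182818286 := Real.exp_one_lt_d9.le
  have hq : (1 / 2 : ℝ) ^ (2 * 1 * b) = (1 / 4 : ℝ) ^ b := by
    rw [show 2 * 1 * b = 2 * b by ring, pow_mul]; norm_num
  have ht0 : 0 ≤ t := by positivity
  have htb : t ≤ 1 / (2 * 10 ^ 9) := by
    have hmono := quartic_geom_le_32 hb
    have h1 : t ≤ 3072 * 2.7182818286 * ((b : ℝ) ^ 4 * (1 / 4 : ℝ) ^ b) := by
      rw [ht, hq]
      have : 0 ≤ (b : ℝ) ^ 4 * (1 / 4 : ℝ) ^ b := by positivity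
      nlinarith [he.trans he1, Real.exp_pos (24 * N * |β|)]
    refine h1.trans ((mul_le_mul_of_nonneg_left hmono (by norm_num)).trans ?_)
    norm_num
  have habs : |t| ≤ 1 := by rw [abs_of_nonneg ht0]; linarith [htb]
  have hexp : |Real.exp t - 1| ≤ 2 * |t| := Real.abs_exp_sub_one_le habs
  rw [abs_of_nonneg ht0] at hexp
  have : meshRadiusSC N β b 1 = Real.exp t - 1 := rfl
  rw [this]
  calc Real.exp t - 1 ≤ |Real.exp t - 1| := le_abs_self _
    _ ≤ 2 * t := hexp
    _ ≤ 1 / 10 ^ 9 := by linarith [htb]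

/-- **The class of record at THE NUMBER `a⋆` holds at EVERY mesh `b ≥ 32`** (window `1`) throughout the strong window — a certified
`b_hand(a⋆) ≤ 32` on the activity axis (every compact `G`, every lattice representation). -/
theorem blockedActivityClassW_radiusKP_of_ge_32 {β : ℝ} (hβ : 216 * (r.N : ℝ) * |β| ≤ 1) {b : ℕ} (hb : 32 ≤ b) :
    BlockedActivityClassW r.ρ β b 1 (radiusKP (1 / 3552)) := by
  refine blockedActivityClassW_mono G (blockedActivityClassW_strongCoupling_mesh G r hβ (le_trans (by norm_num) hb) le_rfl) ?_
  refine (meshRadiusSC_le_of_ge_32 hβ hb).trans ?_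
  exact le_trans (by norm_num) (radiusKP_bounds (ε := 1 / 3552) (by norm_num)).1.le

/-- … hence `UnivShellCond r.ρ β b 1 (1∕3552)` at EVERY mesh `b ≥ 32` in the strong window, read through the activity currency. -/
theorem univShellCond_of_ge_32 {β : ℝ} (hβ : 216 * (r.N : ℝ) * |β| ≤ 1) {b : ℕ} (hb : 32 ≤ b) :
    UnivShellCond r.ρ β b 1 (1 / 3552) :=
  univShellCond_of_blockedActivityW_sharp (blockedActivityClassW_radiusKP_of_ge_32 G r hβ hb) (by norm_num) le_rfl

end Strong

end Summit.QuantumFields.YangMills.Cruxes.IR.BlockedActivity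

end
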